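import Summits.QuantumFields.BalabanUV.Beta.GAN24.FineReadoutDecay
import Summits.QuantumFields.BalabanUV.Beta.GAN24.CombesThomasFibre
import Literature.MathematicalPhysics.QuantumFieldTheory.Balaban1983to89.Beta.ResolventComposition
import Literature.MathematicalPhysics.QuantumFieldTheory.Balaban1983to89.T4GaugeActionRatePair

/-!
# `BalabanUV.Beta.GAN24.StencilSlotE3HLeg` — binder row G-an2-4 / (CONV-C), S-slot, road «S3-Taylor»: THE NORMALISED MINIMISER LEGS
# `H̃_N := N^{d+2}·wH_N` AND `G̃_N := N^{d+2}·GamΦ_N = −H̃_Nᵀ` OF THE THIRD-JET SANDWICHES, AT `d = 3`, IN THE SANDWICH CURRENCY (block-`ℓ¹`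
# decay, literal argument shapes) — from leaf-16's (N1) `FineReadoutDecay.exists_wH_decay` (row owner b2b-balaban-gan24-p1, gen 4)

NOT IN PRINT; OUR PROOF ATTEMPT.  HONEST FRAMING (cell contract, verbatim): «discharging `BetaPertH` makes Bałaban's UV stability
UNCONDITIONAL — a real constructive-QFT result; it is NOT the continuum limit and NOT the Clay problem.»  HONEST DEPENDENCY (verbatim):
«continuum YM on T⁴ ⇐ BetaPertH ∧ nine spine estimates (0/9 proved); BetaPertH ⇐ (D1) ∧ (D4) ∧ CAP+tail; G-an2-4 gates asym, D1 and
NE2/3/4.»  [folklore] re-currencying of (N1) BY NAME (`FineReadoutDecay.exists_wH_decay`, `ResolventComposition.GamΦ_eq_neg_wH`,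
`CombesThomasFibre.quo_sub_zsmul`, `T4GaugeActionRatePair.exp_sup_le_exp_l1`); 0 `def`, 0 cite, 0 `Prop` mirror, 0 sorry.  These are the legs `H`
(vertex), `B` (right) and `A` (left, via `GamΦ`) of `TaylorSandwich.sandwich_bound` for every (V-H) and (Λ) row; it discharges NONE of those rows.
NOT continuum, NOT Clay.

## What is proved (`d = 3`, every `Lc` with `NeZero Lc`; `N = Lc^{j+1}`)
* `norm_factor` — `((Lc:ℝ)^(j+1))^(3+2) · (((Lc^(j+1) : ℕ) : ℝ)^5)⁻¹ = 1`.
* **`hLeg_three`** — `∃ C κ, 0 < κ ∧ 0 ≤ C ∧` for all `j κ l z`: `|((Lc:ℝ)^(j+1))^(3+2) · wH_N κ l z| ≤ C · e^{−κ·|quo N z|₁}` (block-`ℓ¹` currency, κ = κ₀∕4).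
* **`vertexLeg_three`** — the VERTEX leg in the sandwich's literal shape: `|N^{3+2}·wH_N κ″ κ′ (u − N•u′)| ≤ C·e^{−κ|quo N u − u′|₁}`.
* **`gamLeg_three`** — the LEFT leg: `|N^{3+2}·GamΦ_N α x′ l w| ≤ C·e^{−κ|x′ − quo N w|₁}` (`GamΦ = −wHᵀ`).
-/

noncomputable section

open Literature.MathematicalPhysics.QuantumFieldTheory
open Literature.MathematicalPhysics.QuantumFieldTheory.Balaban1983to89
open Literature.MathematicalPhysics.QuantumFieldTheory.Balaban1983to89.Beta
open Literature.MathematicalPhysics.QuantumFieldTheory.LatticeForm (quo)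
open B12Sec2to5 (l1 l1_nonneg)
open B4ContourShift (supNorm)
open ExpKernelCalculus (l1_sub_symm)
open KernelSpecInstance (wH)
open KKTFluctuationKernel (GamΦ)
open ResolventComposition (GamΦ_eq_neg_wH)
open T4GaugeActionRatePair (exp_sup_le_exp_l1)
open Summit.QuantumFields.BalabanUV.Beta.GAN24.CombesThomasFibre (quo_sub_zsmul)
open Summit.QuantumFields.BalabanUV.Beta.GAN24.FineReadoutDecay (exists_wH_decay)

namespace Summit.QuantumFields.BalabanUV.Beta.GAN24.StencilSlotE3HLeg

variable {Lc : ℕ} [NeZero Lc]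

/-- [folklore] The unit factor cancels: `((Lc:ℝ)^(j+1))^(3+2) · (((Lc^(j+1) : ℕ) : ℝ)^5)⁻¹ = 1`. -/
theorem norm_factor (j : ℕ) : ((Lc : ℝ) ^ (j + 1)) ^ (3 + 2) * ((((Lc ^ (j + 1) : ℕ) : ℝ) ^ 5)⁻¹) = 1 := by
  have hL : ((Lc : ℝ) ^ (j + 1)) ≠ 0 := pow_ne_zero _ (Nat.cast_ne_zero.2 (NeZero.ne Lc))
  push_cast
  exact mul_inv_cancel₀ (pow_ne_zero _ hL)

/-- **THE NORMALISED MINIMISER COLUMN IN BLOCK-`ℓ¹` CURRENCY** (`d = 3`): `|N^{d+2}·wH_N κ l z| ≤ C·e^{−κ|quo N z|₁}` for every member,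
one `(C, κ)` for all levels (`κ = κ₀∕(3+1)` from (N1)'s sup-norm rate `κ₀`). [folklore] -/
theorem hLeg_three : ∃ C κ : ℝ, 0 < κ ∧ 0 ≤ C ∧ ∀ (j : ℕ) (k l : Fin (3 + 1)) (z : Fin (3 + 1) → ℤ),
    |((Lc : ℝ) ^ (j + 1)) ^ (3 + 2) * wH (N := Lc ^ (j + 1)) k l z| ≤ C * Real.exp (-κ * l1 (quo (Lc ^ (j + 1)) z)) := by
  obtain ⟨κ₀, C, hκ₀, hC, h⟩ := exists_wH_decay (Lc := Lc)
  refine ⟨C, κ₀ / ((3 : ℝ) + 1), by positivity, hC, fun j k l z => ?_⟩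
  set Np : ℝ := ((Lc : ℝ) ^ (j + 1)) ^ (3 + 2) with hNp
  set Mi : ℝ := ((((Lc ^ (j + 1) : ℕ) : ℝ) ^ 5)⁻¹) with hMi
  set E : ℝ := Real.exp (-(κ₀ * supNorm (quo (Lc ^ (j + 1)) z))) with hE
  have hN : (0 : ℝ) ≤ Np := by positivity
  have key : Np * Mi = 1 := by rw [hNp, hMi]; exact norm_factor j
  have h1 : |wH (N := Lc ^ (j + 1)) k l z| ≤ C * Mi * E := h j k l z
  have hconv : E ≤ Real.exp (-(κ₀ / ((3 : ℝ) + 1)) * l1 (quo (Lc ^ (j + 1)) z)) := by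
    have := exp_sup_le_exp_l1 (d := 3) hκ₀.le (quo (Lc ^ (j + 1)) z)
    rw [Nat.cast_ofNat] at this
    exact this
  calc |Np * wH (N := Lc ^ (j + 1)) k l z| = Np * |wH (N := Lc ^ (j + 1)) k l z| := by
        rw [abs_mul, abs_of_nonneg hN]
    _ ≤ Np * (C * Mi * E) := mul_le_mul_of_nonneg_left h1 hN
    _ = C * (Np * Mi) * E := by ring
    _ = C * E := by rw [key, mul_one]
    _ ≤ C * Real.exp (-(κ₀ / ((3 : ℝ) + 1)) * l1 (quo (Lc ^ (j + 1)) z)) := mul_le_mul_of_nonneg_left hconv hC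

/-- **THE THREE LEGS OF THE SANDWICH AT `d = 3`** [folklore]: one `(C, κ)` such that, for every member `j` (`N = Lc^{j+1}`),
(vertex) `|N^{d+2}·wH_N κ″ κ′ (u − N•u′)| ≤ C·e^{−κ|quo N u − u′|₁}`, (right) `|N^{d+2}·wH_N l′ β (y − N•z′)| ≤ C·e^{−κ|quo N y − z′|₁}` and
(left) `|N^{d+2}·GamΦ_N α x′ l w| ≤ C·e^{−κ|x′ − quo N w|₁}` — the hypotheses `hH`, `hB`, `hA` of `TaylorSandwich.sandwich_bound` literally. -/
theorem legs_three : ∃ C κ : ℝ, 0 < κ ∧ 0 ≤ C ∧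
    (∀ (j : ℕ) (k l : Fin (3 + 1)) (u u' : Fin (3 + 1) → ℤ),
      |((Lc : ℝ) ^ (j + 1)) ^ (3 + 2) * wH (N := Lc ^ (j + 1)) k l (u - (((Lc ^ (j + 1) : ℕ) : ℤ)) • u')| ≤
        C * Real.exp (-κ * l1 (quo (Lc ^ (j + 1)) u - u'))) ∧
    (∀ (j : ℕ) (α l : Fin (3 + 1)) (x' w : Fin (3 + 1) → ℤ),
      |((Lc : ℝ) ^ (j + 1)) ^ (3 + 2) * GamΦ (N := Lc ^ (j + 1)) α x' l w| ≤
        C * Real.exp (-κ * l1 (x' - quo (Lc ^ (j + 1)) w))) := by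
  obtain ⟨C, κ, hκ, hC, h⟩ := hLeg_three (Lc := Lc)
  refine ⟨C, κ, hκ, hC, fun j k l u u' => ?_, fun j α l x' w => ?_⟩
  · have h1 := h j k l (u - (((Lc ^ (j + 1) : ℕ) : ℤ)) • u')
    rwa [quo_sub_zsmul] at h1
  · rw [GamΦ_eq_neg_wH, mul_neg, abs_neg]
    have h1 := h j l α (w - (((Lc ^ (j + 1) : ℕ) : ℤ)) • x')
    rw [quo_sub_zsmul, l1_sub_symm] at h1
    exact h1

end Summit.QuantumFields.BalabanUV.Beta.GAN24.StencilSlotE3HLeg
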